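/-
Copyright: the b2b-balaban T⁴-continuum CRUX team, row NE7b OWNER lineage `t4-ne7b-p1` (gen 123). Project licence.
-/
import Summits.QuantumFields.BalabanUV.T4Continuum.Spine.NE7b.SupZdExponentialSums

/-!
# THE QUADRATIC FORM OF THE INFINITE-VOLUME COARSE OPERATOR IS `ℓ²`-BOUNDED: an exponentially decaying kernel on `ℤ^d`, `|T(b,b′)| ≤
# C·e^{−δ|b − b′|₁}`, satisfies the SCHUR TEST on every finite set, `Σ_{b ∈ S}(Σ_{b′ ∈ S}T(b,b′)g b′)² ≤ (C·K_δ)²·Σ_{b′ ∈ S} g b′²`, hence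
# `(Σ_{b ∈ S} h b·Σ_{b′ ∈ S}T(b,b′)g b′)² ≤ (C·K_δ)²·(Σ_S h²)(Σ_S g²)`; for the entries of `T_∞ = Q′H_∞⁻¹Q′*` ((186)'s decay) this is the boundedness
# half of Lax–Milgram on the finitely supported coarse functions, the coercivity half being (186) `zd_coarse_floor` — together the
# hypotheses for inverting `T_∞` on `ℓ²(ℤ^d)` (row NE7b, node U5c; (186)∕(189) BY NAME; [folklore])

Cell `pub-balaban`, sub-cell `t4`, spine estimate NE7b (`T4WeightBudget.RelWeightBound`; the cell's OWN estimate — NOT PRINTED in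
[Bałaban 1983–89], NOT PROVED).  Crux-route work under `Spine/NE7b/` by the row OWNER (`t4-ne7b-p1` gen 123, file (191)) under FREEZE
(0)'s crux-prover clause; NOTHING of Bałaban's is named as a Lean object, valued or asserted; no `T4Continuum/Support` leaf typed; no `def`,
no notation; zero `sorry`.  Imports (BY NAME): the OWNER's (189) `…SupZdExponentialSums` (`finset_sum_exp_l1_le`; through it (186)
`zd_coarse_entry_decay`, `zd_coarse_floor`), Mathlib's `Finset.sum_sq_le_sum_mul_sum_of_sq_le_mul` and `Finset.sum_mul_sq_le_sq_mul_sq`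
(Cauchy–Schwarz for finsets).

WHY (located).  The infinite-volume next-scale Hessian is `T_∞⁻¹` (up to `(n+1)^d`); (186) gave [B6]'s coercivity of `⟨g, T_∞g⟩` on finitely
supported `g`, (187) symmetry, (189) the `ℓ^∞` row bounds.  Inversion on `ℓ²(ℤ^d)` by Lax–Milgram needs the form to be BOUNDED in `ℓ²` on the
dense subspace of finitely supported functions: the Schur test with the symmetric weight `e^{−δ|b − b′|₁}` — row sums AND column sums are
`≤ C·K_δ` ((189) `finset_sum_exp_l1_le`, the `ℓ¹` distance being symmetric) — via the weighted Cauchy–Schwarz inequality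
`(Σ_{b′}T g)² ≤ (Σ_{b′}|T|)(Σ_{b′}|T|g²)` (`Finset.sum_sq_le_sum_mul_sum_of_sq_le_mul` with `r = Tg`, `f = |T|`, `g = |T|g²`: no square roots).

WHAT IS PROVED ([folklore]; `X d = ℤ^d`, `|b|₁ = Σ_i|b i|`, `K_δ = (2∕(1 − e^{−δ}))^d`):
* §1 `natAbs_sub_comm_sum` (`|b − b′|₁ = |b′ − b|₁`), **`kernel_l2_bound`** (`δ > 0`, `|T(b,b′)| ≤ C·e^{−δ|b − b′|₁}`, finite `S`, any `g`:
  `Σ_{b ∈ S}(Σ_{b′ ∈ S}T(b,b′)g b′)² ≤ (C·K_δ)²·Σ_{b′ ∈ S}g b′²`), **`kernel_form_sq_le`** (`(Σ_{b ∈ S}h b·Σ_{b′ ∈ S}T(b,b′)g b′)² ≤ (C·K_δ)²(Σ_S h²)(Σ_S g²)`).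
* §2 **`zd_coarse_form_bounded`**: `d ≥ 3`, `a > 0`, `λ < min(2,a)`, `Λ ≥ 0` ⟹ `∃ M > 0` (from `(d, a, λ, Λ)` only): for ALL `n`, `V : ℤ^d → [−λ, Λ]`,
  ANY bounded block columns `Ψ`, every finite `S` and all `g, h`:
  `(Σ_{b ∈ S}h b·Σ_{b′ ∈ S}((n+1)^{−d}Σ_{q ∈ B n b}Ψ_{b′} q)·g b′)² ≤ M²·(Σ_{b ∈ S}h b²)·(Σ_{b′ ∈ S}g b′²)` and
  `Σ_{b ∈ S}(Σ_{b′ ∈ S}((n+1)^{−d}Σ_{q ∈ B n b}Ψ_{b′} q)·g b′)² ≤ M²·Σ_{b′ ∈ S}g b′²`.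
* §3 toy (`d = 3`).

HONEST (what this is NOT).  Boundedness of the form only — the inversion itself (Lax–Milgram on `ℓ²(ℤ^d)`, then `ℓ^∞` and locality by a
Combes–Thomas argument) is the sequel; `d ≥ 3` for §2 only; the LINEAR column only; scalar skeleton ((A3), NC-NE7b-α UNRULED); nothing of
the covariant propagators of [B4]–[B6]; nothing of Bałaban's.  BY-NAME EFFECT ON THE WALL: NONE.  NE7b NOT PRINTED ∕ NOT PROVED; spine PROVED
0∕9; rung (B)+1 — the programme's measures remain FINITE-torus statements; NOT the mass gap, NOT Clay.  HONEST DEPENDENCY: continuum YM on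
T⁴ ⇐ BetaPertH ∧ nine spine estimates (0∕9 proved); BetaPertH ⇐ (D1) ∧ (D4) ∧ CAP+tail; G-an2-4 gates asym, D1 and NE2∕3∕4.
-/

set_option autoImplicit false

noncomputable section

namespace Summit.QuantumFields.BalabanUV.T4Continuum.NE7b.SupZdCoarseForm

open Real
open Literature.MathematicalPhysics.QuantumFieldTheory.Balaban1983to89
open B6QGQLower276 (X e blk B side chart mem_B sum_B sum_B_const card_cube blk_chart)
open SupZdCoarseOperator (zd_coarse_entry_decay)
open SupZdExponentialSums (finset_sum_exp_l1_le)

variable {d : ℕ}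

/-! ## §1. The Schur test for exponentially decaying kernels on finite subsets of `ℤ^d` -/

/-- The `ℓ¹` distance on `ℤ^d` is symmetric (termwise `|b i − b′ i| = |b′ i − b i|`). [folklore] -/
theorem natAbs_sub_comm_sum (b b' : X d) :
    ∑ i, (((b i - b' i).natAbs : ℕ) : ℝ) = ∑ i, (((b' i - b i).natAbs : ℕ) : ℝ) :=
  Finset.sum_congr rfl fun i _ => by rw [← Int.natAbs_neg, neg_sub]

section Kernel

variable {δ C : ℝ} (hδ : 0 < δ) (T : X d → X d → ℝ)
  (hT : ∀ b b', |T b b'| ≤ C * exp (-(δ * ∑ i, (((b i - b' i).natAbs : ℕ) : ℝ))))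

include hδ hT in
/-- **THE SCHUR TEST**: `|T(b,b′)| ≤ C·e^{−δ|b − b′|₁}` ⟹ on every finite `S`, `Σ_{b ∈ S}(Σ_{b′ ∈ S}T(b,b′)g b′)² ≤ (C·K_δ)²·Σ_{b′ ∈ S}g b′²` — weighted
Cauchy–Schwarz in `b′`, then the column sums in `b` ((189) `finset_sum_exp_l1_le` twice, the distance being symmetric). [folklore] -/
theorem kernel_l2_bound (S : Finset (X d)) (g : X d → ℝ) :
    ∑ b ∈ S, (∑ b' ∈ S, T b b' * g b') ^ 2 ≤ (C * (2 * (1 - exp (-δ))⁻¹) ^ d) ^ 2 * ∑ b' ∈ S, g b' ^ 2 := by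
  set K : ℝ := (2 * (1 - exp (-δ))⁻¹) ^ d with hK
  have hC : ∀ b, 0 ≤ C := fun b => by
    have h := (abs_nonneg _).trans (hT b b)
    exact le_of_mul_le_mul_right (by rw [zero_mul]; exact h) (exp_pos _)
  -- row sums and column sums of `|T|` over `S`
  have hrow : ∀ b, ∑ b' ∈ S, |T b b'| ≤ C * K := fun b =>
    calc ∑ b' ∈ S, |T b b'| ≤ ∑ b' ∈ S, C * exp (-(δ * ∑ i, (((b i - b' i).natAbs : ℕ) : ℝ))) := Finset.sum_le_sum fun b' _ => hT b b'
      _ = C * ∑ b' ∈ S, exp (-(δ * ∑ i, (((b i - b' i).natAbs : ℕ) : ℝ))) := (Finset.mul_sum _ _ _).symm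
      _ ≤ C * K := mul_le_mul_of_nonneg_left (finset_sum_exp_l1_le hδ b S) (hC b)
  have hcol : ∀ b', ∑ b ∈ S, |T b b'| ≤ C * K := fun b' =>
    calc ∑ b ∈ S, |T b b'| ≤ ∑ b ∈ S, C * exp (-(δ * ∑ i, (((b' i - b i).natAbs : ℕ) : ℝ))) :=
          Finset.sum_le_sum fun b _ => by rw [← natAbs_sub_comm_sum b b']; exact hT b b'
      _ = C * ∑ b ∈ S, exp (-(δ * ∑ i, (((b' i - b i).natAbs : ℕ) : ℝ))) := (Finset.mul_sum _ _ _).symm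
      _ ≤ C * K := mul_le_mul_of_nonneg_left (finset_sum_exp_l1_le hδ b' S) (hC b')
  -- weighted Cauchy–Schwarz in `b′`
  have hCS : ∀ b ∈ S, (∑ b' ∈ S, T b b' * g b') ^ 2 ≤ (∑ b' ∈ S, |T b b'|) * ∑ b' ∈ S, |T b b'| * g b' ^ 2 := fun b _ =>
    Finset.sum_sq_le_sum_mul_sum_of_sq_le_mul S (fun b' _ => abs_nonneg _) (fun b' _ => mul_nonneg (abs_nonneg _) (sq_nonneg _))
      fun b' _ => by rw [mul_pow, ← sq_abs (T b b'), sq]; exact le_of_eq (by ring)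
  calc ∑ b ∈ S, (∑ b' ∈ S, T b b' * g b') ^ 2
      ≤ ∑ b ∈ S, (C * K) * ∑ b' ∈ S, |T b b'| * g b' ^ 2 :=
        Finset.sum_le_sum fun b hb => (hCS b hb).trans (mul_le_mul_of_nonneg_right (hrow b)
          (Finset.sum_nonneg fun b' _ => mul_nonneg (abs_nonneg _) (sq_nonneg _)))
    _ = (C * K) * ∑ b' ∈ S, g b' ^ 2 * ∑ b ∈ S, |T b b'| := by
        rw [← Finset.mul_sum, Finset.sum_comm]
        congr 1
        refine Finset.sum_congr rfl fun b' _ => ?_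
        rw [Finset.mul_sum]
        exact Finset.sum_congr rfl fun b _ => by ring
    _ ≤ (C * K) * ∑ b' ∈ S, g b' ^ 2 * (C * K) :=
        mul_le_mul_of_nonneg_left (Finset.sum_le_sum fun b' _ => mul_le_mul_of_nonneg_left (hcol b') (sq_nonneg _))
          (mul_nonneg (hC 0) (pow_nonneg (mul_nonneg zero_le_two (inv_nonneg.2 (sub_nonneg.2 (exp_le_one_iff.2 (by linarith))))) d))
    _ = (C * K) ^ 2 * ∑ b' ∈ S, g b' ^ 2 := by rw [← Finset.sum_mul]; ring

include hδ hT in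
/-- **THE FORM IS `ℓ²`-BOUNDED**: `(Σ_{b ∈ S}h b·Σ_{b′ ∈ S}T(b,b′)g b′)² ≤ (C·K_δ)²·(Σ_S h²)(Σ_S g²)` (Cauchy–Schwarz in `b` and the Schur test).
[folklore] -/
theorem kernel_form_sq_le (S : Finset (X d)) (g h : X d → ℝ) :
    (∑ b ∈ S, h b * ∑ b' ∈ S, T b b' * g b') ^ 2
      ≤ (C * (2 * (1 - exp (-δ))⁻¹) ^ d) ^ 2 * (∑ b ∈ S, h b ^ 2) * ∑ b' ∈ S, g b' ^ 2 := by
  have h1 := Finset.sum_mul_sq_le_sq_mul_sq S h (fun b => ∑ b' ∈ S, T b b' * g b')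
  have h2 := kernel_l2_bound hδ T hT S g
  calc (∑ b ∈ S, h b * ∑ b' ∈ S, T b b' * g b') ^ 2 ≤ (∑ b ∈ S, h b ^ 2) * ∑ b ∈ S, (∑ b' ∈ S, T b b' * g b') ^ 2 := h1
    _ ≤ (∑ b ∈ S, h b ^ 2) * ((C * (2 * (1 - exp (-δ))⁻¹) ^ d) ^ 2 * ∑ b' ∈ S, g b' ^ 2) :=
        mul_le_mul_of_nonneg_left h2 (Finset.sum_nonneg fun _ _ => sq_nonneg _)
    _ = _ := by ring

end Kernel

/-! ## §2. THE END: the quadratic form of `T_∞` is `ℓ²`-bounded on finitely supported functions -/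

/-- **HEADLINE — THE FORM OF `T_∞` IS `ℓ²`-BOUNDED, UNIFORMLY IN THE FINITE SUPPORT**: `d ≥ 3`, `a > 0`, `λ < min(2,a)`, `Λ ≥ 0` ⟹ `∃ M > 0`
(from `(d, a, λ, Λ)` only): for ALL `n`, `V : ℤ^d → [−λ, Λ]`, ANY bounded block columns `Ψ_{b′}` of `H_V` (`H_VΨ_{b′} = 𝟙[blk n · = b′]`), every
finite `S` and all coarse `g, h`: `(Σ_{b ∈ S}h b·Σ_{b′ ∈ S}T_∞(b,b′)g b′)² ≤ M²(Σ_S h²)(Σ_S g²)` and `Σ_{b ∈ S}(Σ_{b′ ∈ S}T_∞(b,b′)g b′)² ≤ M²Σ_S g²`,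
with `T_∞(b,b′) = (n+1)^{−d}Σ_{q ∈ B n b}Ψ_{b′} q` displayed — (186)'s decay and §1; with (186) `zd_coarse_floor` these are Lax–Milgram's
hypotheses on the finitely supported functions. [folklore] -/
theorem zd_coarse_form_bounded (hd : 3 ≤ d) (a : ℝ) (ha : 0 < a) {lam Lam : ℝ} (hlam : lam < min 2 a) (hLam : 0 ≤ Lam) :
    ∃ M : ℝ, 0 < M ∧ ∀ (n : ℕ) (V : X d → ℝ), (∀ p, -lam ≤ V p) → (∀ p, V p ≤ Lam) →
      ∀ (Ψ : X d → X d → ℝ) (BΨ : X d → ℝ), (∀ b' p, |Ψ b' p| ≤ BΨ b') →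
      (∀ b' p, ((n : ℝ) + 1) ^ 2 * ∑ μ, (2 * Ψ b' p - Ψ b' (p + e μ) - Ψ b' (p - e μ))
        + a / ((n : ℝ) + 1) ^ d * ∑ q ∈ B n (blk n p), Ψ b' q + V p * Ψ b' p = if blk n p = b' then 1 else 0) →
      ∀ (S : Finset (X d)) (g h : X d → ℝ),
        (∑ b ∈ S, h b * ∑ b' ∈ S, ((((n : ℝ) + 1) ^ d)⁻¹ * ∑ q ∈ B n b, Ψ b' q) * g b') ^ 2
            ≤ M ^ 2 * (∑ b ∈ S, h b ^ 2) * ∑ b' ∈ S, g b' ^ 2 ∧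
        ∑ b ∈ S, (∑ b' ∈ S, ((((n : ℝ) + 1) ^ d)⁻¹ * ∑ q ∈ B n b, Ψ b' q) * g b') ^ 2 ≤ M ^ 2 * ∑ b' ∈ S, g b' ^ 2 := by
  obtain ⟨C, δ, hC, hδ, H186⟩ := zd_coarse_entry_decay (d := d) hd a ha hlam hLam
  have hK : 0 < (2 * (1 - exp (-δ))⁻¹) ^ d := pow_pos (mul_pos two_pos (inv_pos.2 (sub_pos.2 (exp_lt_one_iff.2 (by linarith))))) d
  refine ⟨C * (2 * (1 - exp (-δ))⁻¹) ^ d, by positivity, ?_⟩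
  intro n V hV hV' Ψ BΨ hΨB hΨ S g h
  have hT : ∀ b b' : X d, |(((n : ℝ) + 1) ^ d)⁻¹ * ∑ q ∈ B n b, Ψ b' q| ≤ C * exp (-(δ * ∑ i, (((b i - b' i).natAbs : ℕ) : ℝ))) :=
    fun b b' => H186 n V hV hV' Ψ BΨ hΨB hΨ b b'
  exact ⟨kernel_form_sq_le hδ (fun b b' => (((n : ℝ) + 1) ^ d)⁻¹ * ∑ q ∈ B n b, Ψ b' q) hT S g h,
    kernel_l2_bound hδ (fun b b' => (((n : ℝ) + 1) ^ d)⁻¹ * ∑ q ∈ B n b, Ψ b' q) hT S g⟩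

/-! ## §3. Toy -/

/-- Toy (`d = 3`, `a = 1`, `λ = 0`, `Λ = 1`): the `ℓ²` bound constant exists. -/
example : ∃ M : ℝ, 0 < M :=
  let ⟨M, hM, _⟩ := zd_coarse_form_bounded (d := 3) le_rfl 1 one_pos (lam := 0) (Lam := 1)
    (by rw [min_eq_right (by norm_num : (1 : ℝ) ≤ 2)]; norm_num) zero_le_one
  ⟨M, hM⟩

end Summit.QuantumFields.BalabanUV.T4Continuum.NE7b.SupZdCoarseForm
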